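import Mathlib
import Summits.ResolutionOfSingularities.ResolutionOfSingularities.Theorems.HomologicalConductorPersistenceSTDCore
import Literature.RingTheory.CohomologyAnnihilator.BirationalTransfer
import HarnessLib

/-!
# STD ⇒ persistence for `k`-subalgebras of a field (the shape of a tower step)

Crux `HomologicalConductor.Persistence` (stmt-ResolutionOfSingularities-16484), chain W4.4b,
candidate mechanism M-A′ (STD, tri-2 FS-5). The composition lemma of
`Theorems/HomologicalConductorPersistenceSTDCore.lean` (p466272) specialised to the situation of a
tower step: `B ≤ C` `k`-subalgebras of a field `K` with `Frac B = K` (so `C ⊆ Frac B`, `↥C` is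
torsion-free and birational over `↥B`), both noetherian, the algebra structure `↥B → ↥C` any one
compatible with the inclusions into `K` (e.g. the inclusion). If for every `t` with `c ∈ caᵗ⁺¹(B)`
some STD_{t,e}(`↥B → ↥C`) holds (every `e`-th `↥C`-syzygy lies in the Ω-closure of the strict
transforms of `(t+1)`-th `↥B`-syzygies, stated by the universal property), then
`ca B ⊆ ca C` as subsets of `K` — exactly the shape of the core stub of line `birth`
(`C = nrm (B[ca B/x])` or its localisation at the centre), now with an `x`-FREE hypothesis.

* `exists_mul_mem_of_isFractionRing` — `C ⊆ Frac B` inside `K` when `Frac B = K`;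
* `image_subset_image_of_omegaClosure` — the statement above.

`[OURS · L1 w44b]`; bookkeeping over landed lemmas, not a statement of any manuscript.
-/

-- single-problem summit: the doubled namespace component is forced
set_option linter.dupNamespace false

noncomputable section

open CategoryTheory CategoryTheory.Abelian
open scoped nonZeroDivisors

namespace Summit.ResolutionOfSingularities.ResolutionOfSingularities.Theorems.HomologicalConductor.PersistenceSTDStep

open Literature.RingTheory.CohomologyAnnihilator
open Literature.RingTheory.Localization
open Summit.ResolutionOfSingularities.ResolutionOfSingularities.Theorems.HomologicalConductor.PersistenceSTDCore
  (algebraMap_mem_cohomologyAnnihilator_of_omegaClosure)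

variable {k K : Type} [Field k] [Field K] [Algebra k K]

/-- If `Frac B = K` then every `k`-subalgebra `C` of `K` lies in `Frac B`: every `s ∈ C` has
`b * s ∈ B` for some non-zero `b ∈ B`. [folklore] -/
theorem exists_mul_mem_of_isFractionRing (B C : Subalgebra k K) [IsFractionRing ↥B K] :
    ∀ s ∈ C, ∃ b ∈ B, b ≠ 0 ∧ b * s ∈ B := by
  intro s _
  obtain ⟨a, b, hb, rfl⟩ := IsFractionRing.div_surjective (A := ↥B) s
  have hb0 : (b : ↥B) ≠ 0 := nonZeroDivisors.ne_zero hb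
  have hbK : (b : K) ≠ 0 := fun h => hb0 (Subtype.ext h)
  refine ⟨(b : K), b.2, hbK, ?_⟩
  change (b : K) * ((a : K) / (b : K)) ∈ B
  rw [mul_div_cancel₀ _ hbK]
  exact a.2

/-- **STD ⇒ persistence, subalgebra form (the shape of one tower step).** Let `B`, `C` be
noetherian `k`-subalgebras of a field `K` with `Frac B = K`, with an algebra structure `↥B → ↥C`
compatible with the inclusions into `K`. Suppose that for every `t` with `c ∈ caᵗ⁺¹(↥B)` there is an
`e` such that every `e`-th syzygy of every finitely generated `↥C`-module lies in every class of
`↥C`-modules containing the strict transforms of `(t+1)`-th `↥B`-syzygies and the finitely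
generated projectives and closed under isomorphism, binary products, retracts and first syzygies
(STD_{t,e}). Then every `c ∈ ca(↥B)` maps into `ca(↥C)`; in particular
`ca B ⊆ ca C` as subsets of `K` (`image_coe_subset_image_coe_of_omegaClosure`). [folklore] -/
theorem algebraMap_mem_cohomologyAnnihilator_of_omegaClosure' (B C : Subalgebra k K)
    [Algebra ↥B ↥C] [IsScalarTower ↥B ↥C K] [IsNoetherianRing ↥B] [IsNoetherianRing ↥C]
    [IsFractionRing ↥B K] {c : ↥B} (hc : c ∈ cohomologyAnnihilator ↥B)
    (hSTD : ∀ t : ℕ, c ∈ cohomologyAnnihilatorOfDegree ↥B (t + 1) → ∃ e : ℕ,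
      ∀ (M N : ModuleCat.{0} ↥C), Module.Finite ↥C M → IsSyzygy e M N →
      ∀ Q : ModuleCat.{0} ↥C → Prop,
        (∀ Y : ModuleCat.{0} ↥C, (∃ (X Y₀ : ModuleCat.{0} ↥B) (φ : Y₀ →+ Y), Module.Finite ↥B X ∧
            IsSyzygy (t + 1) X Y₀ ∧ (∀ (b : ↥B) (y : Y₀), φ (b • y) = algebraMap ↥B ↥C b • φ y) ∧
            Function.Injective φ ∧ Submodule.span ↥C (Set.range φ) = ⊤) → Q Y) →
        (∀ P : ModuleCat.{0} ↥C, Module.Finite ↥C P → Projective P → Q P) →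
        (∀ Y Y' : ModuleCat.{0} ↥C, Q Y → Nonempty (Y ≅ Y') → Q Y') →
        (∀ Y₁ Y₂ : ModuleCat.{0} ↥C, Q Y₁ → Q Y₂ → Q (ModuleCat.of ↥C (Y₁ × Y₂))) →
        (∀ (Y Y' : ModuleCat.{0} ↥C) (i : Y' ⟶ Y) (r : Y ⟶ Y'), i ≫ r = 𝟙 Y' → Q Y → Q Y') →
        (∀ Y N' : ModuleCat.{0} ↥C, Q Y → IsSyzygy 1 Y N' → Q N') → Q N) :
    algebraMap ↥B ↥C c ∈ cohomologyAnnihilator ↥C := by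
  haveI : Module.IsTorsionFree ↥B ↥C := Subalgebra.isTorsionFree_of_isScalarTower
  have hbir : ∀ s : ↥C, ∃ b : ↥B, b ∈ (↥B)⁰ ∧ ∃ r : ↥B,
      algebraMap ↥B ↥C b * s = algebraMap ↥B ↥C r :=
    Subalgebra.exists_mem_nonZeroDivisors_mul_eq (exists_mul_mem_of_isFractionRing B C)
  exact algebraMap_mem_cohomologyAnnihilator_of_omegaClosure (B := ↥B) (C := ↥C) hbir hc hSTD

/-- **STD ⇒ `ca B ⊆ ca C` in `K`** (images of the Literature ideals), for `B ≤ C` with the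
INCLUSION as algebra structure: the form consumed by the core stub of line `birth`. [folklore] -/
theorem image_coe_subset_image_coe_of_omegaClosure (B C : Subalgebra k K) (hBC : B ≤ C)
    [IsNoetherianRing ↥B] [IsNoetherianRing ↥C] [IsFractionRing ↥B K]
    (hSTD : letI := (Subalgebra.inclusion hBC).toRingHom.toAlgebra
      ∀ c : ↥B, c ∈ cohomologyAnnihilator ↥B →
      ∀ t : ℕ, c ∈ cohomologyAnnihilatorOfDegree ↥B (t + 1) → ∃ e : ℕ,
      ∀ (M N : ModuleCat.{0} ↥C), Module.Finite ↥C M → IsSyzygy e M N →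
      ∀ Q : ModuleCat.{0} ↥C → Prop,
        (∀ Y : ModuleCat.{0} ↥C, (∃ (X Y₀ : ModuleCat.{0} ↥B) (φ : Y₀ →+ Y), Module.Finite ↥B X ∧
            IsSyzygy (t + 1) X Y₀ ∧ (∀ (b : ↥B) (y : Y₀), φ (b • y) = algebraMap ↥B ↥C b • φ y) ∧
            Function.Injective φ ∧ Submodule.span ↥C (Set.range φ) = ⊤) → Q Y) →
        (∀ P : ModuleCat.{0} ↥C, Module.Finite ↥C P → Projective P → Q P) →
        (∀ Y Y' : ModuleCat.{0} ↥C, Q Y → Nonempty (Y ≅ Y') → Q Y') →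
        (∀ Y₁ Y₂ : ModuleCat.{0} ↥C, Q Y₁ → Q Y₂ → Q (ModuleCat.of ↥C (Y₁ × Y₂))) →
        (∀ (Y Y' : ModuleCat.{0} ↥C) (i : Y' ⟶ Y) (r : Y ⟶ Y'), i ≫ r = 𝟙 Y' → Q Y → Q Y') →
        (∀ Y N' : ModuleCat.{0} ↥C, Q Y → IsSyzygy 1 Y N' → Q N') → Q N) :
    ((↑) : ↥B → K) '' (cohomologyAnnihilator ↥B : Set ↥B) ⊆
      ((↑) : ↥C → K) '' (cohomologyAnnihilator ↥C : Set ↥C) := by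
  letI : Algebra ↥B ↥C := (Subalgebra.inclusion hBC).toRingHom.toAlgebra
  haveI : IsScalarTower ↥B ↥C K := Subalgebra.isScalarTower_inclusion hBC
  rintro x ⟨c, hc, rfl⟩
  refine ⟨algebraMap ↥B ↥C c, ?_, rfl⟩
  exact algebraMap_mem_cohomologyAnnihilator_of_omegaClosure' B C hc (hSTD c hc)

end Summit.ResolutionOfSingularities.ResolutionOfSingularities.Theorems.HomologicalConductor.PersistenceSTDStep

end
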